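import Literature.Barriers.CriticalPhenomena.PlaquetteWalkHoleRootDeadDoorBelow
import HarnessLib

/-!
# Barrier catalogue (SAWScalingLimit): ONE LIVE ROW BELOW — at most one crossable west side of the root column below the root
row ⇒ the under route is EMPTY

Leaf of `PlaquetteWalkHoleRootDeadDoorBelow` (the second prefix-loop separation: dead door `holeS | rootS` + floor) and, through
it, of `PlaquetteWalkHoleRootHoleColumn` (§2: a winding excursion crosses the west sides `vert w.1 y`, `y ≤ w.2 − 1`, of the root
column an odd number of times) and `PlaquetteWalkHoleRootPrefixLoop` (`windC`, one winding number along `J`, the jump). Setting: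
root plaquette `w` rooted at `W`, hole `holeFaceW w ∉ D`, far cell `farW w`. A west side `vert w.1 y` is DEAD when one of its two
cells `(w.1 − 1, y)`, `(w.1, y)` is absent.

§1 ★★★★ `ΩG.false_of_under_excursion_westEdge_oneLiveRow` — THE FOURTH PREFIX-LOOP SEPARATION: if every west side strictly
between the root row and the row `y₁ ≤ w.2 − 1` is dead, no class-`B2a` UNDER-walk's excursion polygon exits a slot through
`vert w.1 y₁`: that midpoint is joined to the LOWER corner of the root edge straight down the west sides of the rows
`w.2 − 1, …, y₁ + 1` (dead: no mid-edge of any walk) and the upper half of row `y₁`'s (the excursion's own mid-edge, so not the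
prefix's) — by induction on the row; the far cell's top midpoint is joined to the UPPER corner as always; `ΩG.windC_jump`.
§2 ★★★★★ `ΩG.WE_eq_excursionWinding_of_under_oneLiveRow` — **AT MOST ONE LIVE WEST SIDE `y₁ ≤ w.2 − 1` OF THE ROOT COLUMN ⇒ NO
WOUND UNDER-WALK**, in every domain. It contains: the thin side (`w.2 − 1` is the bottom row: the door is the only candidate),
the dead door + floor of `PlaquetteWalkHoleRootDeadDoorBelow` (`y₁ = w.2 − 2`), and the NEW cases «door alive, the side below it
dead, nothing further below» (`holeSS` or `rootSS` removed with the hole two rows above the wall: the lane's A4 entries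
`holeSS ⇒ under EMPTY` and `rootSS ⇒ under w₁-killed` — the latter is in fact EMPTY too) and «door dead, next side dead, floor
three rows below». Row-mirror twin `…_of_over_oneLiveRowN`.
§3 Boxes (any defect list `S ∋ h` missing the far cell): ★★★★★ `lawL_box_oneLiveRow2_not_wound_under` (`h.2 = 2`, one of
`holeS, rootS, holeSS = (h.1, 0), rootSS = (h.1 + 1, 0)` in `S`), ★★★★★ `lawL_box_oneLiveRow3_not_wound_under` (`h.2 = 3`, one of
`holeS, rootS` AND one of `(h.1, 1), (h.1 + 1, 1)` in `S` — the lane's kit j300087 TIMEOUTs `{(3,0)/(4,0), holeS/rootS}`), and the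
top twins.

Not in print; venture lane «pcv-sawmu», seat b-step0 gen 28 (kit j300087 «ringnear»).

References: A. Glazman, I. Manolescu, arXiv:1708.00395v3, §1 (Fig. 1, Fig. 2, remark after eq. (1)), §2.1, §4.2, Lemma 2.1
[GlazmanManolescu2019]; A. Glazman, Electron. Commun. Probab. 20 (2015) no. 86, Lemma 3.1, proof pp. 6–7
[Glazman2015WeightedSAW]; R. Courant, H. Robbins, *What is Mathematics?* (1941/1958), Ch. V Appendix §2 (the even–odd
rule) [CourantRobbins1958]; L. V. Ahlfors, *Complex Analysis*, 3rd ed. (1979), Ch. 4 §2.1 [AhlforsCA1979].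
-/

noncomputable section

open Set Function Complex
open Literature.Topology.PlaneTopology

namespace Literature.Probability.RandomPlanarGeometry.SAW.YangBaxter

open Real
open Literature.Barriers.CriticalPhenomena.PlaquetteWalk (mirrorRowFace)

open private rev_snd_nth rev_snd_length rev_firstHit from Literature.Probability.RandomPlanarGeometry.YangBaxterSAWGeneralDomain

open private len_eq side_jOut segment_pJ_even toC_midPt_side_mem_sideSeg
  from Literature.Probability.RandomPlanarGeometry.YangBaxterSAWExcursionJordan

open private sideSeg_coords_W from Literature.Probability.RandomPlanarGeometry.YangBaxterSAWExcursionJordan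

open private fSeg_coords hSeg_coords toC_midPt_mem_crossSeg not_mem_sideSeg_N_of_mem_fSeg_hSeg
  from Literature.Barriers.CriticalPhenomena.PlaquetteWalkHoleRootPrefixLoop

/-- The two segments through the hole miss every closed west side on the root column's line below the root row.
[folklore] -/
private theorem not_mem_sideSeg_W_of_mem_fSeg_hSeg_row (w : Face) {c : Face} (hc1 : c.1 = w.1) (hc2 : c.2 ≤ w.2 - 1) {q : ℂ}
    (hq : q ∈ fSeg w ∨ q ∈ hSeg w) : q ∉ sideSeg c .W := by
  intro hq'
  obtain ⟨hx, -, hy⟩ := sideSeg_coords_W hq'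
  rw [hc1] at hx
  have hc2' : (c.2 : ℝ) ≤ w.2 - 1 := by exact_mod_cast hc2
  rcases hq with hq | hq
  · obtain ⟨t, -, ht1, hx', -⟩ := fSeg_coords w hq
    rw [hx'] at hx; linarith
  · obtain ⟨hy', -, -⟩ := hSeg_coords w hq
    rw [hy'] at hy; linarith

namespace ΩG

variable {D : Set Face} {w : Face} {ω : ΩG D (w.side .W) (farW w)}

/-! ## §1 The fourth prefix-loop separation: one live row -/

/-- ★★★★ **THE FOURTH PREFIX-LOOP SEPARATION LEMMA.** Hole absent; `y₁ ≤ w.2 − 1` a row such that every west side of the root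
column strictly between the root row and row `y₁` is dead (`(w.1 − 1, y) ∉ D ∨ (w.1, y) ∉ D` for `y₁ < y ≤ w.2 − 1`); `ω` a
class-`B2a` UNDER-walk. Then no slot of the excursion polygon exits through `vert w.1 y₁`.
[cite: CourantRobbins1958, Ch. V Appendix §2 (The Jordan Curve Theorem for Polygons: the even–odd rule)]
[cite: AhlforsCA1979, Ch. 4 §2.1 (index of a point with respect to a closed curve)]
[cite: Glazman2015WeightedSAW, Lemma 3.1 (proof, pp. 6–7: the classes of walks through a rhombus)] -/
theorem false_of_under_excursion_westEdge_oneLiveRow (hh : holeFaceW w ∉ D) (hr : RootedFace D (w.side .W) (farW w))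
    (h : ω.IsB2a) (hS : ω.2.firstSideG = .S) {y₁ : ℤ} (hy₁ : y₁ ≤ w.2 - 1)
    (hdead : ∀ y : ℤ, y₁ < y → y ≤ w.2 - 1 → ((w.1 - 1, y) : Face) ∉ D ∨ ((w.1, y) : Face) ∉ D)
    (hJ : ∃ j, j < ω.Mv ∧ (ω.jFace h j).side (ω.jOut hr h j) = MidEdge.vert w.1 y₁) : False := by
  have hM := ω.three_le_Mv hr h
  have hF := ω.fh_lt h
  have h1 := ω.one_le_firstHitG_far
  have hlen : ω.2.arcs.length = ω.2.firstHitG + ω.Mv := len_eq h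
  set F := ω.2.firstHitG with hFdef
  set n := ω.2.arcs.length with hndef
  have hnthF : ω.2.nth F = (farW w).side .S := by rw [hFdef, ω.2.nth_firstHitG, hS]
  obtain ⟨j, hj, hje⟩ := hJ
  -- no prefix mid-edge is a west side of the root column in a row `y₁ ≤ y ≤ w.2 - 1`
  have hpre : ∀ i, 1 ≤ i → i ≤ F → ∀ y : ℤ, y₁ ≤ y → y ≤ w.2 - 1 → ω.2.nth i ≠ MidEdge.vert w.1 y := by
    intro i hi1 hiF y hyl hyu e
    have hd := ω.2.door_nth (j := i) (by omega) (by omega)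
    rw [e] at hd
    simp only [MidEdge.faces] at hd
    rcases eq_or_lt_of_le hyl with hey | hlt
    · subst hey
      rw [← hje, side_jOut (hr := hr) h hj] at e
      have := ω.2.nth_inj (by omega) (by omega) e
      omega
    · rcases hdead y hlt hyu with hx | hx
      · exact hx hd.1
      · exact hx hd.2
  -- the auxiliary points
  set q1 : ℂ := toC ((holeFaceW w).base + Side.N.endA) with hq1
  set mN : ℂ := toC (midPt ((farW w).side .N)) with hmN
  set mW : ℂ := toC (midPt (MidEdge.vert w.1 y₁)) with hmW
  -- P1: the top side of the hole
  have hP1 : segment ℝ (cHi w) q1 = sideSeg (holeFaceW w) .N := by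
    rw [segment_symm, sideSeg, cHi]
    congr 2
    obtain ⟨a, b⟩ := w; simp [holeFaceW, Face.base, Side.endB]; ring
  have w1 : ω.windC (cHi w) = ω.windC q1 := by
    refine windC_eq_of_segment fun z hz k hk hzk => ?_
    rw [hP1] at hz
    obtain ⟨i, hi1, hiF, e⟩ := exists_nth_eq_of_mem_pCedge_sideSeg hh h hS hk hzk hz
      (fun q hq => not_mem_sideSeg_N_of_mem_fSeg_hSeg (by simp [holeFaceW]) hq)
    have hd := ω.2.door_nth (j := i) (by omega) (by omega)
    rw [e] at hd
    have : ((holeFaceW w).side .N).faces.1 = holeFaceW w := by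
      obtain ⟨a, b⟩ := w; simp [holeFaceW, Face.side, MidEdge.faces]
    rw [this] at hd
    exact hh hd.1
  -- P2: the right half of the top side of the far cell
  have hP2 : segment ℝ q1 mN ⊆ sideSeg (farW w) .N := by
    refine (convex_segment _ _).segment_subset ?_ (toC_midPt_side_mem_sideSeg _ _)
    have e : q1 = toC ((farW w).base + Side.N.endB) := by
      rw [hq1]; congr 1; obtain ⟨a, b⟩ := w; simp [holeFaceW, farW, Face.base, Side.endA, Side.endB]; ring
    rw [e]; exact right_mem_segment _ _ _
  have w2 : ω.windC q1 = ω.windC mN := by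
    refine windC_eq_of_segment fun z hz k hk hzk => ?_
    obtain ⟨i, hi1, hiF, e⟩ := exists_nth_eq_of_mem_pCedge_sideSeg hh h hS hk hzk (hP2 hz)
      (fun q hq => not_mem_sideSeg_N_of_mem_fSeg_hSeg (by simp [farW]) hq)
    have hle := firstHitG_le_of_nth_eq (ω := ω) (by omega) e
    have ei : i = F := by omega
    rw [ei, hnthF] at e
    exact absurd (Face.side_injective (farW w) e) (by decide)
  -- P3: straight down the west sides of the rows `w.2 - 1, …, y₁ + 1`, corner to corner
  let Q : ℕ → ℂ := fun k => toC (Face.base ((w.1, w.2 - 1 - (k : ℤ)) : Face) + Side.W.endB)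
  have hQ0 : Q 0 = cLo w := by
    show toC (Face.base ((w.1, w.2 - 1 - ((0 : ℕ) : ℤ)) : Face) + Side.W.endB) = cLo w
    rw [cLo]; congr 1; obtain ⟨a, b⟩ := w
    refine Prod.ext ?_ ?_
    · simp [Face.base, Side.endA, Side.endB]
    · simp [Face.base, Side.endA, Side.endB]; ring
  have hQseg : ∀ k : ℕ, segment ℝ (Q k) (Q (k + 1)) = sideSeg ((w.1, w.2 - 1 - k) : Face) .W := by
    intro k
    show segment ℝ (toC (Face.base ((w.1, w.2 - 1 - (k : ℤ)) : Face) + Side.W.endB))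
      (toC (Face.base ((w.1, w.2 - 1 - ((k + 1 : ℕ) : ℤ)) : Face) + Side.W.endB)) = sideSeg ((w.1, w.2 - 1 - k) : Face) .W
    rw [sideSeg, segment_symm]
    congr 2
    refine Prod.ext ?_ ?_
    · simp [Face.base, Side.endA, Side.endB]
    · simp [Face.base, Side.endA, Side.endB]; ring
  have w3 : ∀ k : ℕ, (k : ℤ) ≤ w.2 - 1 - y₁ → ω.windC (Q k) = ω.windC (cLo w) := by
    intro k
    induction k with
    | zero => intro _; rw [hQ0]
    | succ k ih =>
      intro hk
      rw [← ih (by push_cast at hk ⊢; omega)]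
      symm
      refine windC_eq_of_segment fun z hz k' hk' hzk => ?_
      rw [hQseg k] at hz
      obtain ⟨i, hi1, hiF, e⟩ := exists_nth_eq_of_mem_pCedge_sideSeg hh h hS hk' hzk hz
        (fun q hq => not_mem_sideSeg_W_of_mem_fSeg_hSeg_row w (by simp) (by simp only; omega) hq)
      exact hpre i hi1 hiF (w.2 - 1 - k) (by push_cast at hk; omega) (by omega) e
  -- P4: the upper half of row `y₁`'s west side
  set K : ℕ := (w.2 - 1 - y₁).toNat with hKdef
  have hK : (K : ℤ) = w.2 - 1 - y₁ := by rw [hKdef]; omega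
  have hQK : Q K = toC (Face.base ((w.1, y₁) : Face) + Side.W.endB) := by
    show toC (Face.base ((w.1, w.2 - 1 - (K : ℤ)) : Face) + Side.W.endB) = _
    rw [hK, sub_sub_cancel]
  have hP4 : segment ℝ (Q K) mW ⊆ sideSeg ((w.1, y₁) : Face) .W := by
    rw [hQK]
    refine (convex_segment _ _).segment_subset (right_mem_segment _ _ _) ?_
    have e : MidEdge.vert w.1 y₁ = Face.side ((w.1, y₁) : Face) .W := rfl
    rw [hmW, e]
    exact toC_midPt_side_mem_sideSeg _ _
  have w4 : ω.windC (Q K) = ω.windC mW := by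
    refine windC_eq_of_segment fun z hz k hk hzk => ?_
    obtain ⟨i, hi1, hiF, e⟩ := exists_nth_eq_of_mem_pCedge_sideSeg hh h hS hk hzk (hP4 hz)
      (fun q hq => not_mem_sideSeg_W_of_mem_fSeg_hSeg_row w (by simp) (by simp; omega) hq)
    exact hpre i hi1 hiF y₁ le_rfl hy₁ e
  -- the two midpoints lie on `J`
  obtain ⟨j₀, hj₀, hj₀e⟩ := exists_jOut_eq_farW_N hh hr h hS
  have wN : ω.windC mN = ω.windC (ω.pJ hr h 0) := by
    refine windC_pJ_edge hh hr h hS (k := 2 * j₀) (by omega) ?_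
    rw [segment_pJ_even h hj₀, hj₀e]
    exact toC_midPt_mem_crossSeg _
  have wW : ω.windC mW = ω.windC (ω.pJ hr h 0) := by
    refine windC_pJ_edge hh hr h hS (k := 2 * j) (by omega) ?_
    rw [segment_pJ_even h hj, hje]
    exact toC_midPt_mem_crossSeg _
  have := windC_jump hh h hS
  rw [w1, w2, wN, ← wW, ← w4, w3 K (by omega), sub_self] at this
  exact zero_ne_one this

/-! ## §2 At most one live west side below the root row ⇒ no wound under-walk -/

/-- ★★★★ **The excursion polygon of an under-walk does not wind around the root when at most one west side of the root column
below the root row is alive.** The lower-east parity law (`ΩG.odd_card_westEdgeLE_of_AJ_ne_zero`) gives an odd number of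
excursion crossings of those west sides; dead sides carry none, so one of them is row `y₁`'s; §1.
[cite: CourantRobbins1958, Ch. V Appendix §2 (the even–odd rule)] [cite: AhlforsCA1979, Ch. 4 §2.1 (index of a point)]
[cite: Glazman2015WeightedSAW, Lemma 3.1 (proof, pp. 6–7)] -/
theorem AJ_root_eq_zero_of_under_oneLiveRow (hh : holeFaceW w ∉ D) {y₁ : ℤ} (hy₁ : y₁ ≤ w.2 - 1)
    (hcol : ∀ y : ℤ, y ≤ w.2 - 1 → y ≠ y₁ → ((w.1 - 1, y) : Face) ∉ D ∨ ((w.1, y) : Face) ∉ D)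
    (ω : ΩG D (w.side .W) (farW w)) (hr : RootedFace D (w.side .W) (farW w)) (h : ω.IsB2a)
    (hS : ω.2.firstSideG = .S) : ω.AJ hr h (toC (midPt (w.side .W))) = 0 := by
  classical
  have hF := ω.fh_lt h
  have hlen : ω.2.arcs.length = ω.2.firstHitG + ω.Mv := len_eq h
  by_contra hA
  have hodd := ω.odd_card_westEdgeLE_of_AJ_ne_zero hr h hA
  have hpos := hodd.pos
  rw [Finset.card_pos] at hpos
  obtain ⟨k, hk⟩ := hpos
  rw [Finset.mem_filter, Finset.mem_Ioc] at hk
  obtain ⟨⟨hk1, hk2⟩, hwest⟩ := hk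
  have hd := ω.2.door_nth (j := k) (by omega) (by omega)
  cases hnth : ω.2.nth k with
  | slant x y => rw [hnth] at hwest; exact absurd hwest (by simp [IsWestEdgeLE])
  | vert x y =>
    rw [hnth] at hwest hd
    simp only [IsWestEdgeLE] at hwest
    obtain ⟨hx, hy⟩ := hwest
    subst hx
    simp only [MidEdge.faces] at hd
    have hyy : y = y₁ := by
      by_contra hne
      rcases hcol y hy hne with hc | hc
      · exact hc hd.1
      · exact hc hd.2
    subst hyy
    refine false_of_under_excursion_westEdge_oneLiveRow hh hr h hS hy₁ (fun y' hl hu => hcol y' hu (by omega))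
      ⟨k - ω.2.firstHitG - 1, by omega, ?_⟩
    rw [side_jOut (hr := hr) h (by omega), show ω.2.firstHitG + (k - ω.2.firstHitG - 1) + 1 = k by omega, hnth]

/-- ★★★★★ **AT MOST ONE LIVE WEST SIDE OF THE ROOT COLUMN BELOW THE ROOT ROW ⇒ NO WOUND UNDER-WALK** (either orientation of the
winding witness). Hole absent; for some row `y₁ ≤ w.2 − 1`, every other row `y ≤ w.2 − 1` has `(w.1 − 1, y) ∉ D` or
`(w.1, y) ∉ D`. Then every class-`B2a` under-walk at the far cell is unwound, in every domain. Special cases: the thin side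
(`y₁ = w.2 − 1`, nothing below); the dead door with its floor (`PlaquetteWalkHoleRootDeadDoorBelow`, `y₁ = w.2 − 2`); the door
alive with `holeSS` or `rootSS` absent and nothing further below; a dead door and a dead side under it with a floor three rows
down. [cite: GlazmanManolescu2019, Lemma 2.1 (statement, "in the form given in [Gl]"), §1 (Fig. 2)]
[cite: Glazman2015WeightedSAW, Lemma 3.1 (proof, pp. 6–7)] [cite: CourantRobbins1958, Ch. V Appendix §2 (the even–odd rule)] -/
theorem WE_eq_excursionWinding_of_under_oneLiveRow (hh : holeFaceW w ∉ D) {y₁ : ℤ} (hy₁ : y₁ ≤ w.2 - 1)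
    (hcol : ∀ y : ℤ, y ≤ w.2 - 1 → y ≠ y₁ → ((w.1 - 1, y) : Face) ∉ D ∨ ((w.1, y) : Face) ∉ D)
    (ω : ΩG D (w.side .W) (farW w)) (hr : RootedFace D (w.side .W) (farW w)) (h : ω.IsB2a)
    (hS : ω.2.firstSideG = .S) (θ : ℝ) :
    ω.WE (fun _ => θ) = excursionWinding θ ω.2.firstSideG (ω.z1 hr h) ω.1 := by
  by_contra hW
  rcases ω.AJ_ne_zero_or_rev_of_wound hr h θ hW with hA | hA
  · exact hA (AJ_root_eq_zero_of_under_oneLiveRow hh hy₁ hcol ω hr h hS)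
  · have h' := ω.rev_isB2a hr h
    have hS' : (ω.rev hr).2.firstSideG = .S := by rw [ω.rev_firstSide hr h]; exact hS
    exact hA (AJ_root_eq_zero_of_under_oneLiveRow hh hy₁ hcol (ω.rev hr) hr h' hS')

/-- The reflection in the root row on a cell, in coordinates. [cite: GlazmanManolescu2019, §4.2 (lattice symmetries)] -/
private theorem mirrorRowFace_mkR1 (w : Face) (x y : ℤ) : mirrorRowFace w.2 ((x, y) : Face) = (x, 2 * w.2 - y) := by
  simp [mirrorRowFace]

/-- ★★★★★ **AT MOST ONE LIVE WEST SIDE OF THE ROOT COLUMN ABOVE THE ROOT ROW ⇒ NO WOUND OVER-WALK** (row-mirror twin: for some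
row `y₁ ≥ w.2 + 1`, every other row `y ≥ w.2 + 1` has `(w.1 − 1, y) ∉ D` or `(w.1, y) ∉ D`).
[cite: GlazmanManolescu2019, §1 (Fig. 1, Fig. 2), §4.2 (lattice symmetries), Lemma 2.1]
[cite: Glazman2015WeightedSAW, Lemma 3.1 (proof, pp. 6–7)] [cite: CourantRobbins1958, Ch. V Appendix §2 (the even–odd rule)] -/
theorem WE_eq_excursionWinding_of_over_oneLiveRowN (hh : holeFaceW w ∉ D) {y₁ : ℤ} (hy₁ : w.2 + 1 ≤ y₁)
    (hcol : ∀ y : ℤ, w.2 + 1 ≤ y → y ≠ y₁ → ((w.1 - 1, y) : Face) ∉ D ∨ ((w.1, y) : Face) ∉ D)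
    (ω : ΩG D (w.side .W) (farW w)) (hr : RootedFace D (w.side .W) (farW w)) (h : ω.IsB2a)
    (hN : ω.2.firstSideG = .N) (θ : ℝ) :
    ω.WE (fun _ => θ) = excursionWinding θ ω.2.firstSideG (ω.z1 hr h) ω.1 := by
  by_contra hW
  have hr' := rootedFace_rowMirrorDom w hr
  have h' := ω.mirrorFar_isB2a hr h
  have hh' : holeFaceW w ∉ rowMirrorDom w D := by rwa [mem_rowMirrorDom, mirrorRowFace_holeFaceW]
  have hcol' : ∀ y : ℤ, y ≤ w.2 - 1 → y ≠ 2 * w.2 - y₁ →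
      ((w.1 - 1, y) : Face) ∉ rowMirrorDom w D ∨ ((w.1, y) : Face) ∉ rowMirrorDom w D := by
    intro y hy hne
    rw [mem_rowMirrorDom, mem_rowMirrorDom, mirrorRowFace_mkR1, mirrorRowFace_mkR1]
    exact hcol (2 * w.2 - y) (by omega) (by omega)
  have hS' : ω.mirrorFar.2.firstSideG = .S := by rw [mirrorFar_firstSideG, hN]; rfl
  exact absurd (WE_eq_excursionWinding_of_under_oneLiveRow hh' (y₁ := 2 * w.2 - y₁) (by omega) hcol' ω.mirrorFar hr' h' hS' _)
    (ω.mirrorFar_wound hr h hW)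

end ΩG

end Literature.Probability.RandomPlanarGeometry.SAW.YangBaxter

namespace Literature.Barriers.CriticalPhenomena.PlaquetteWalk

open Literature.Probability.RandomPlanarGeometry.SAW.YangBaxter
open Real Complex

/-! ## §3 Boxes -/

section Boxes

variable {m n : ℕ} {S : List Face} {h : Face}

/-- ★★★★★ **ALL BOXES, HOLE TWO ROWS ABOVE THE BOTTOM WALL: ANY ONE OF `holeS, rootS, holeSS, rootSS` REMOVED ⇒ NO WOUND UNDER-WALK**
(`h.2 = 2`; `holeS = (h.1, 1)`, `rootS = (h.1 + 1, 1)`, `holeSS = (h.1, 0)`, `rootSS = (h.1 + 1, 0)`; whatever else `S ∋ h` removes,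
far cell kept): of the two west sides of the root column below the root row one is dead, the other is the only live one.
(`rootSS` was known to the lane only as a `w₁`-kill of the under route; it EMPTIES it.)
[cite: GlazmanManolescu2019, Lemma 2.1 (statement, "in the form given in [Gl]"), §2.1]
[cite: Glazman2015WeightedSAW, Lemma 3.1 (proof, pp. 6–7)] [cite: CourantRobbins1958, Ch. V Appendix §2 (the even–odd rule)] -/
theorem lawL_box_oneLiveRow2_not_wound_under (hW : 1 ≤ h.1) (hE : h.1 ≤ m) (hS2 : h.2 = 2) (hN : 3 ≤ n) (hh : h ∈ S)
    (hfS : ((h.1 - 1, h.2) : Face) ∉ S)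
    (hc : ((h.1, 1) : Face) ∈ S ∨ ((h.1 + 1, 1) : Face) ∈ S ∨ ((h.1, 0) : Face) ∈ S ∨ ((h.1 + 1, 0) : Face) ∈ S)
    (ω : ΩG (dom (boxMinus m n S)) (Face.side (h.1 + 1, h.2) .W) (farW (h.1 + 1, h.2))) (hb : ω.IsB2a)
    (hS' : ω.2.firstSideG = .S) (θ : ℝ) :
    ω.WE (fun _ => θ) = excursionWinding θ ω.2.firstSideG
      (ω.z1 (rootedFace_hroot_boxMinus_of_mem (farW_hroot_mem_boxMinus_of_not_mem hW hE (by omega) (by omega) hfS) hh) hb)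
      ω.1 := by
  have hhD : holeFaceW ((h.1 + 1, h.2) : Face) ∉ dom (boxMinus m n S) := by
    rw [holeFaceW_hroot]; exact not_mem_dom_boxMinus_of_mem hh
  rcases hc with hc | hc | hc | hc
  · -- holeS removed: row 0 is the only live row
    refine ΩG.WE_eq_excursionWinding_of_under_oneLiveRow (y₁ := 0) hhD (by simp only; omega) (fun y hy hne => ?_) ω _ hb hS' θ
    simp only at hy ⊢
    rcases lt_trichotomy y 0 with hl | he | hg
    · left; intro hm; obtain ⟨hb', -⟩ := mem_dom_boxMinus.1 hm; simp only at hb'; omega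
    · exact absurd he hne
    · left; have ey : y = 1 := by omega
      subst ey; have e : ((h.1 + 1 - 1, (1 : ℤ)) : Face) = (h.1, 1) := Prod.ext (by simp only; omega) rfl
      rw [e]; exact not_mem_dom_boxMinus_of_mem hc
  · refine ΩG.WE_eq_excursionWinding_of_under_oneLiveRow (y₁ := 0) hhD (by simp only; omega) (fun y hy hne => ?_) ω _ hb hS' θ
    simp only at hy ⊢
    rcases lt_trichotomy y 0 with hl | he | hg
    · left; intro hm; obtain ⟨hb', -⟩ := mem_dom_boxMinus.1 hm; simp only at hb'; omega
    · exact absurd he hne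
    · right; have ey : y = 1 := by omega
      subst ey; exact not_mem_dom_boxMinus_of_mem hc
  · -- holeSS removed: row 1 (the door) is the only live row
    refine ΩG.WE_eq_excursionWinding_of_under_oneLiveRow (y₁ := 1) hhD (by simp only; omega) (fun y hy hne => ?_) ω _ hb hS' θ
    simp only at hy ⊢
    rcases lt_trichotomy y 0 with hl | he | hg
    · left; intro hm; obtain ⟨hb', -⟩ := mem_dom_boxMinus.1 hm; simp only at hb'; omega
    · subst he; left
      have e : ((h.1 + 1 - 1, (0 : ℤ)) : Face) = (h.1, 0) := Prod.ext (by simp only; omega) rfl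
      rw [e]; exact not_mem_dom_boxMinus_of_mem hc
    · omega
  · refine ΩG.WE_eq_excursionWinding_of_under_oneLiveRow (y₁ := 1) hhD (by simp only; omega) (fun y hy hne => ?_) ω _ hb hS' θ
    simp only at hy ⊢
    rcases lt_trichotomy y 0 with hl | he | hg
    · left; intro hm; obtain ⟨hb', -⟩ := mem_dom_boxMinus.1 hm; simp only at hb'; omega
    · subst he; right; exact not_mem_dom_boxMinus_of_mem hc
    · omega

/-- ★★★★★ **ALL BOXES, HOLE THREE ROWS ABOVE THE BOTTOM WALL: the door `holeS | rootS` dead AND the side below it dead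
(`(h.1, 1)` or `(h.1 + 1, 1)` removed) ⇒ NO WOUND UNDER-WALK** (`h.2 = 3`; row `0` is the only live row). The lane's kit j300087
TIMEOUTs `{holeSS / rootSS, holeS / rootS}` in the 7-row frame, decided: none.
[cite: GlazmanManolescu2019, Lemma 2.1 (statement, "in the form given in [Gl]"), §2.1]
[cite: Glazman2015WeightedSAW, Lemma 3.1 (proof, pp. 6–7)] [cite: CourantRobbins1958, Ch. V Appendix §2 (the even–odd rule)] -/
theorem lawL_box_oneLiveRow3_not_wound_under (hW : 1 ≤ h.1) (hE : h.1 ≤ m) (hS3 : h.2 = 3) (hN : 4 ≤ n) (hh : h ∈ S)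
    (hfS : ((h.1 - 1, h.2) : Face) ∉ S) (hc2 : ((h.1, 2) : Face) ∈ S ∨ ((h.1 + 1, 2) : Face) ∈ S)
    (hc1 : ((h.1, 1) : Face) ∈ S ∨ ((h.1 + 1, 1) : Face) ∈ S)
    (ω : ΩG (dom (boxMinus m n S)) (Face.side (h.1 + 1, h.2) .W) (farW (h.1 + 1, h.2))) (hb : ω.IsB2a)
    (hS' : ω.2.firstSideG = .S) (θ : ℝ) :
    ω.WE (fun _ => θ) = excursionWinding θ ω.2.firstSideG
      (ω.z1 (rootedFace_hroot_boxMinus_of_mem (farW_hroot_mem_boxMinus_of_not_mem hW hE (by omega) (by omega) hfS) hh) hb)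
      ω.1 := by
  have hhD : holeFaceW ((h.1 + 1, h.2) : Face) ∉ dom (boxMinus m n S) := by
    rw [holeFaceW_hroot]; exact not_mem_dom_boxMinus_of_mem hh
  refine ΩG.WE_eq_excursionWinding_of_under_oneLiveRow (y₁ := 0) hhD (by simp only; omega) (fun y hy hne => ?_) ω _ hb hS' θ
  simp only at hy ⊢
  have e1 : ((h.1 + 1 - 1, y) : Face) = (h.1, y) := Prod.ext (by simp only; omega) rfl
  rw [e1]
  rcases lt_trichotomy y 0 with hl | he | hg
  · left; intro hm; obtain ⟨hb', -⟩ := mem_dom_boxMinus.1 hm; simp only at hb'; omega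
  · exact absurd he hne
  · rcases (show y = 1 ∨ y = 2 by omega) with rfl | rfl
    · rcases hc1 with hc | hc
      · exact Or.inl (not_mem_dom_boxMinus_of_mem hc)
      · exact Or.inr (not_mem_dom_boxMinus_of_mem hc)
    · rcases hc2 with hc | hc
      · exact Or.inl (not_mem_dom_boxMinus_of_mem hc)
      · exact Or.inr (not_mem_dom_boxMinus_of_mem hc)

/-- ★★★★★ **TOP TWIN, HOLE TWO ROWS BELOW THE TOP WALL (`h.2 + 3 = n`): any one of `holeN, rootN, holeNN = (h.1, h.2 + 2)`,
`rootNN = (h.1 + 1, h.2 + 2)` removed ⇒ NO WOUND OVER-WALK.** [cite: GlazmanManolescu2019, Lemma 2.1 (statement, "in the form given in [Gl]"), §2.1, §4.2]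
[cite: Glazman2015WeightedSAW, Lemma 3.1 (proof, pp. 6–7)] [cite: CourantRobbins1958, Ch. V Appendix §2 (the even–odd rule)] -/
theorem lawL_box_oneLiveRowN2_not_wound_over (hW : 1 ≤ h.1) (hE : h.1 ≤ m) (hS0 : 0 ≤ h.2) (hN3 : h.2 + 3 = n) (hh : h ∈ S)
    (hfS : ((h.1 - 1, h.2) : Face) ∉ S)
    (hc : ((h.1, h.2 + 1) : Face) ∈ S ∨ ((h.1 + 1, h.2 + 1) : Face) ∈ S ∨ ((h.1, h.2 + 2) : Face) ∈ S ∨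
      ((h.1 + 1, h.2 + 2) : Face) ∈ S)
    (ω : ΩG (dom (boxMinus m n S)) (Face.side (h.1 + 1, h.2) .W) (farW (h.1 + 1, h.2))) (hb : ω.IsB2a)
    (hN' : ω.2.firstSideG = .N) (θ : ℝ) :
    ω.WE (fun _ => θ) = excursionWinding θ ω.2.firstSideG
      (ω.z1 (rootedFace_hroot_boxMinus_of_mem (farW_hroot_mem_boxMinus_of_not_mem hW hE hS0 (by omega) hfS) hh) hb)
      ω.1 := by
  have hhD : holeFaceW ((h.1 + 1, h.2) : Face) ∉ dom (boxMinus m n S) := by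
    rw [holeFaceW_hroot]; exact not_mem_dom_boxMinus_of_mem hh
  have out : ∀ y : ℤ, h.2 + 3 ≤ y → ((h.1 + 1 - 1, y) : Face) ∉ dom (boxMinus m n S) := by
    intro y hy hm; obtain ⟨hb', -⟩ := mem_dom_boxMinus.1 hm; simp only at hb'; omega
  have e1 : ∀ y : ℤ, ((h.1 + 1 - 1, y) : Face) = (h.1, y) := fun y => Prod.ext (by simp only; omega) rfl
  rcases hc with hc | hc | hc | hc
  · refine ΩG.WE_eq_excursionWinding_of_over_oneLiveRowN (y₁ := h.2 + 2) hhD (by simp only; omega) (fun y hy hne => ?_) ω _ hb hN' θ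
    simp only at hy hne ⊢
    rcases (show y = h.2 + 1 ∨ h.2 + 3 ≤ y by omega) with rfl | hg
    · left; rw [e1]; exact not_mem_dom_boxMinus_of_mem hc
    · exact Or.inl (out y hg)
  · refine ΩG.WE_eq_excursionWinding_of_over_oneLiveRowN (y₁ := h.2 + 2) hhD (by simp only; omega) (fun y hy hne => ?_) ω _ hb hN' θ
    simp only at hy hne ⊢
    rcases (show y = h.2 + 1 ∨ h.2 + 3 ≤ y by omega) with rfl | hg
    · right; exact not_mem_dom_boxMinus_of_mem hc
    · exact Or.inl (out y hg)
  · refine ΩG.WE_eq_excursionWinding_of_over_oneLiveRowN (y₁ := h.2 + 1) hhD (by simp only; omega) (fun y hy hne => ?_) ω _ hb hN' θ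
    simp only at hy hne ⊢
    rcases (show y = h.2 + 2 ∨ h.2 + 3 ≤ y by omega) with rfl | hg
    · left; rw [e1]; exact not_mem_dom_boxMinus_of_mem hc
    · exact Or.inl (out y hg)
  · refine ΩG.WE_eq_excursionWinding_of_over_oneLiveRowN (y₁ := h.2 + 1) hhD (by simp only; omega) (fun y hy hne => ?_) ω _ hb hN' θ
    simp only at hy hne ⊢
    rcases (show y = h.2 + 2 ∨ h.2 + 3 ≤ y by omega) with rfl | hg
    · right; exact not_mem_dom_boxMinus_of_mem hc
    · exact Or.inl (out y hg)

end Boxes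

end Literature.Barriers.CriticalPhenomena.PlaquetteWalk
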